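import Literature.NumberTheory.EllipticCurves.FormalInvariantDerivation
import Literature.NumberTheory.EllipticCurves.FormalGroupNegProofs
import HarnessLib

/-!
# The invariant derivatives of `x(z)` and `y(z)`: `Dx = 2y + a₁x + a₃`, `D(2y + a₁x + a₃) = 6x² + b₂x + b₄`,
# poles cleared (proofs only)

Trunk T-NT-EC (Literature/NumberTheory/EllipticCurves). Pure proof file on the way to the formal
Mazur–Tate theta relation (named fact `WeierstrassCurve.padicSigma_theta_formal`,
`CanonicalPAdicHeightThetaProofs.lean`; Blakestad–Grant 2023, Prop. 14). Blakestad–Grant's proof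
compares second logarithmic derivatives along the invariant derivation `D = d/ω`
(`formalInvariantDerivation`, `FormalInvariantDerivation.lean`) and uses, besides the sigma
differential equation, only the function-field identities `Dx = 2y + a₁x + a₃`,
`D(2y + a₁x + a₃) = 6x² + b₂x + b₄` and the Weierstrass equation ("Lemma 10 … follows readily from
the group law on `E/K`"). This file proves them as identities of honest power series in the
parameter `z = -x/y`, for the tree's pole-cleared expansions `X = z²x(z) = formalXMulSq`,
`B = w/z³ = formalWDivCube` (`X·B = 1`), `η = (ω/dz)⁻¹ = formalEta`, over ANY commutative ring:

* `two_mul_formalWDivCube_add_mul_formalEta` — `(2B + zB')·η = B(2 - a₁z - a₃z³B)` (the key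
  identity behind `ω·η = 1`, `FormalInvariantDerivation.lean`, here over every ring);
* `formalXMulSq_sq_eq` — **the Weierstrass equation in `X`**: `X² = X³ + a₁zX² + a₂z²X² + a₃z³X +
  a₄z⁴X + a₆z⁶` (`y² + a₁xy + a₃y = x³ + ⋯` times `z⁶`, with `z³y = -X`, `z²x = X`);
* `formalEta_mul_formalXMulSq` — `η·X = 3X² - 2X + 2a₁zX + 2a₂z²X + a₃z³ + a₄z⁴`
  (i.e. `η = z²(3x² + 2a₂x + a₄ - a₁y)/… `, the value of `dz/ω`);
* `X_mul_formalInvariantDerivation_formalXMulSq` — **`Dx = 2y + a₁x + a₃`**, cleared: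
  `z·D(X) = 2ηX + Ỹ` with `Ỹ := (a₁z - 2)X + a₃z³ = z³(2y + a₁x + a₃)`;
* `formalYTilde_sq` — **`(2y + a₁x + a₃)² = 4x³ + b₂x² + 2b₄x + b₆`**, cleared:
  `Ỹ² = 4X³ + b₂z²X² + 2b₄z⁴X + b₆z⁶`;
* `X_mul_formalInvariantDerivation_formalYTilde` — **`D(2y + a₁x + a₃) = 6x² + b₂x + b₄`**,
  cleared: `z·D(Ỹ) = 3ηỸ + 6X² + b₂z²X + b₄z⁴`;
* `formalXMulSq_sq_mul_formalInvariantDerivation_xInv`, `…_sq_xInv` — for `ξ := z²B = 1/x`: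
  `X²·Dξ = -zỸ` and `X³·D²ξ = 2Ỹ² - X(6X² + b₂z²X + b₄z⁴)` (`D(1/x) = -(2y+a₁x+a₃)/x²`, …).

## Sources

* C. Blakestad, D. Grant, J. Number Theory 249 (2023) (arXiv:1903.02480), §2 (the derivation
  `D = d/ω = 2y d/dx` on the function field), §3 Lemma 10, Prop. 14.
* J. H. Silverman, *AEC* 2nd ed. (2009), III.1 (`b₂, b₄, b₆`, `(2y + a₁x + a₃)² = 4x³ + b₂x² +
  2b₄x + b₆`), IV.1 (`x(z) = z/w`, `y(z) = -1/w`, `ω(z)`).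

## Design notes

Everything is an identity in `R⟦z⟧`; divisions by `z` are performed by `PowerSeries.X_mul_cancel`
and divisions by the unit `B` by `IsUnit.mul_left_cancel`. No definitions, no named facts:
`Ỹ` and `ξ` are written out (`(C a₁ X - 2)·formalXMulSq + C a₃ X³`, `X²·formalWDivCube`).
-/

noncomputable section

open PowerSeries Literature.NumberTheory.EllipticCurves

namespace WeierstrassCurve

variable {R : Type*} [CommRing R] (W : WeierstrassCurve R)

/-! ### The key identity `(2B + zB')η = B(2 - a₁z - a₃z³B)` over any ring -/

/-- **`(2B + zB')·η = B·(2 - a₁z - a₃z³B)`** for `B = w/z³`, `η = 1 - f_w(z, w(z))`: implicit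
differentiation of the fixed point `w = f(z, w)` plus Euler's identity for the cubic `f`
(the computation behind `ω·η = 1`; valid over every commutative ring).
[Silverman AEC IV.1 (expansion of `ω(z)`)] [folklore] -/
theorem two_mul_formalWDivCube_add_mul_formalEta :
    (2 * W.formalWDivCube + X * d⁄dX R W.formalWDivCube) * W.formalEta =
      W.formalWDivCube * (2 - C W.a₁ * X - C W.a₃ * X ^ 3 * W.formalWDivCube) := by
  set B := W.formalWDivCube with hB
  have hwB : W.formalW = X ^ 3 * B := W.formalW_eq_X_pow_mul_formalWDivCube
  have hdw : d⁄dX R (X ^ 3 * B) = 3 * X ^ 2 * B + X ^ 3 * d⁄dX R B := by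
    rw [Derivation.leibniz, Derivation.leibniz_pow, derivative_X, smul_eq_mul, smul_eq_mul]
    simp only [nsmul_eq_mul, Nat.cast_ofNat]
    ring
  have h1 := W.derivative_formalW
  have h2 := W.formalWStep_formalW
  rw [formalWStep] at h2
  rw [hwB, hdw] at h1
  rw [hwB] at h2
  have h3 : X ^ 3 * ((2 * B + X * d⁄dX R B) * W.formalEta) =
      X ^ 3 * (B * (2 - C W.a₁ * X - C W.a₃ * X ^ 3 * B)) := by
    rw [W.formalEta_def, hwB]
    linear_combination X * h1 + 3 * h2
  exact PowerSeries.X_pow_mul_cancel h3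

/-! ### The Weierstrass equation and `η` in terms of `X = z²x` -/

/-- **The Weierstrass equation in `X = z²x(z)`**: `X² = X³ + a₁zX² + a₂z²X² + a₃z³X + a₄z⁴X + a₆z⁶`
(the equation `y² + a₁xy + a₃y = x³ + a₂x² + a₄x + a₆` multiplied by `z⁶`, using `z²x = X`,
`z³y = -X`; equivalently the curve relation for `B = X⁻¹` times `X³`).
[Silverman AEC IV.1 (the expansions of `x(z)`, `y(z)` satisfy the Weierstrass equation)] [folklore] -/
theorem formalXMulSq_sq_eq :
    W.formalXMulSq ^ 2 = W.formalXMulSq ^ 3 + C W.a₁ * X * W.formalXMulSq ^ 2 +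
      C W.a₂ * X ^ 2 * W.formalXMulSq ^ 2 + C W.a₃ * X ^ 3 * W.formalXMulSq +
      C W.a₄ * X ^ 4 * W.formalXMulSq + C W.a₆ * X ^ 6 := by
  have hRel := W.formalWDivCube_eq
  have hBX := W.formalWDivCube_mul_formalXMulSq
  set B := W.formalWDivCube
  set Xs := W.formalXMulSq
  linear_combination Xs ^ 3 * hRel - (Xs ^ 2 - C W.a₁ * X * Xs ^ 2 - C W.a₂ * X ^ 2 * Xs ^ 2 -
    (C W.a₃ * X ^ 3 + C W.a₄ * X ^ 4) * (1 + B * Xs) * Xs -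
    C W.a₆ * X ^ 6 * (1 + B * Xs + B ^ 2 * Xs ^ 2)) * hBX

/-- **`η·X = 3X² - 2X + 2a₁zX + 2a₂z²X + a₃z³ + a₄z⁴`**: the inverse invariant differential
`η = dz/ω` times `z²x`, as a polynomial in `z` and `X` (from `η = 1 - f_w(z, w)`, `w = z³/X` and the
Weierstrass equation). [Silverman AEC IV.1] [folklore] -/
theorem formalEta_mul_formalXMulSq :
    W.formalEta * W.formalXMulSq = 3 * W.formalXMulSq ^ 2 - 2 * W.formalXMulSq +
      2 * C W.a₁ * X * W.formalXMulSq + 2 * C W.a₂ * X ^ 2 * W.formalXMulSq + C W.a₃ * X ^ 3 +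
      C W.a₄ * X ^ 4 := by
  have hEX := W.formalXMulSq_sq_eq
  have hBX := W.formalWDivCube_mul_formalXMulSq
  have hwB : W.formalW = X ^ 3 * W.formalWDivCube := W.formalW_eq_X_pow_mul_formalWDivCube
  rw [W.formalEta_def, hwB]
  set B := W.formalWDivCube
  set Xs := W.formalXMulSq
  linear_combination (-(2 * C W.a₃ * X ^ 3 + 2 * C W.a₄ * X ^ 4 +
      3 * (Xs - Xs ^ 2 - C W.a₁ * X * Xs - C W.a₂ * X ^ 2 * Xs - C W.a₃ * X ^ 3 - C W.a₄ * X ^ 4) +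
      3 * (Xs - Xs ^ 2 - C W.a₁ * X * Xs - C W.a₂ * X ^ 2 * Xs - C W.a₃ * X ^ 3 - C W.a₄ * X ^ 4) *
        B * Xs)) * hBX + (3 * B ^ 2 * Xs) * hEX

/-! ### `Dx = 2y + a₁x + a₃` -/

/-- **`Dx = 2y + a₁x + a₃` in the parameter `z`, poles cleared**: with `D = d/ω = η·d/dz`,
`X = z²x` and `Ỹ := (a₁z - 2)X + a₃z³ = z³(2y + a₁x + a₃)` (`z³y = -X`),
`z · D(X) = 2ηX + Ỹ` — i.e. `D(X/z²) = Ỹ/z³`, which is `dx/ω = 2y + a₁x + a₃`, the defining property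
of `ω = dx/(2y + a₁x + a₃)`. [Blakestad–Grant 2023, §2 (`D = d/ω`); Silverman AEC III.1, IV.1]
[folklore] -/
theorem X_mul_formalInvariantDerivation_formalXMulSq :
    X * W.formalInvariantDerivation W.formalXMulSq =
      2 * W.formalEta * W.formalXMulSq + ((C W.a₁ * X - 2) * W.formalXMulSq + C W.a₃ * X ^ 3) := by
  rw [formalInvariantDerivation_apply]
  have hkey := W.two_mul_formalWDivCube_add_mul_formalEta
  have hBX := W.formalWDivCube_mul_formalXMulSq
  have hdBX : W.formalWDivCube * d⁄dX R W.formalXMulSq +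
      W.formalXMulSq * d⁄dX R W.formalWDivCube = 0 := by
    have h := congrArg (d⁄dX R) hBX
    rwa [Derivation.leibniz, Derivation.map_one_eq_zero, smul_eq_mul, smul_eq_mul] at h
  have hu : IsUnit (W.formalWDivCube ^ 2) := by
    refine IsUnit.pow 2 ?_
    rw [PowerSeries.isUnit_iff_constantCoeff, constantCoeff_formalWDivCube]
    exact isUnit_one
  refine hu.mul_left_cancel ?_
  set B := W.formalWDivCube
  set Xs := W.formalXMulSq
  set η := W.formalEta
  linear_combination (X * η * B) * hdBX -
    (X * η * d⁄dX R B + 2 * η * B + (C W.a₁ * X - 2) * B) * hBX - hkey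

/-! ### The Weierstrass equation for `Ỹ = z³(2y + a₁x + a₃)` and `D Ỹ` -/

/-- **`(2y + a₁x + a₃)² = 4x³ + b₂x² + 2b₄x + b₆`, poles cleared**:
`Ỹ² = 4X³ + b₂z²X² + 2b₄z⁴X + b₆z⁶` for `Ỹ = (a₁z - 2)X + a₃z³`. [Silverman AEC III.1 (the
`b`-form of the Weierstrass equation)] [folklore] -/
theorem formalYTilde_sq :
    ((C W.a₁ * X - 2) * W.formalXMulSq + C W.a₃ * X ^ 3) ^ 2 =
      4 * W.formalXMulSq ^ 3 + C W.b₂ * X ^ 2 * W.formalXMulSq ^ 2 +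
      2 * C W.b₄ * X ^ 4 * W.formalXMulSq + C W.b₆ * X ^ 6 := by
  have hEX := W.formalXMulSq_sq_eq
  simp only [b₂, b₄, b₆, map_add, map_mul, map_pow, map_ofNat]
  linear_combination (4 : R⟦X⟧) * hEX

/-- **`D(2y + a₁x + a₃) = 6x² + b₂x + b₄`, poles cleared**: `z · D(Ỹ) = 3ηỸ + 6X² + b₂z²X + b₄z⁴`
(from `Dx = 2y + a₁x + a₃`, `Dz = η` and the value of `η·X`). [Blakestad–Grant 2023, §2
(`D y = (3x² + 2a₂x + a₄ - a₁y)`-type rules for `D = d/ω`); Silverman AEC III.1] [folklore] -/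
theorem X_mul_formalInvariantDerivation_formalYTilde :
    X * W.formalInvariantDerivation ((C W.a₁ * X - 2) * W.formalXMulSq + C W.a₃ * X ^ 3) =
      3 * W.formalEta * ((C W.a₁ * X - 2) * W.formalXMulSq + C W.a₃ * X ^ 3) +
      6 * W.formalXMulSq ^ 2 + C W.b₂ * X ^ 2 * W.formalXMulSq + C W.b₄ * X ^ 4 := by
  have hF1 := W.X_mul_formalInvariantDerivation_formalXMulSq
  have hηX := W.formalEta_mul_formalXMulSq
  have hD : W.formalInvariantDerivation ((C W.a₁ * X - 2) * W.formalXMulSq + C W.a₃ * X ^ 3) =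
      C W.a₁ * W.formalEta * W.formalXMulSq +
        (C W.a₁ * X - 2) * W.formalInvariantDerivation W.formalXMulSq +
        3 * C W.a₃ * X ^ 2 * W.formalEta := by
    have h2 : W.formalInvariantDerivation (2 : R⟦X⟧) = 0 := Derivation.map_natCast _ 2
    simp only [map_add, map_sub, Derivation.leibniz, Derivation.leibniz_pow,
      formalInvariantDerivation_C, formalInvariantDerivation_X, h2, smul_eq_mul, nsmul_eq_mul,
      Nat.cast_ofNat, Nat.add_one_sub_one, sub_zero]
    ring
  rw [hD]
  simp only [b₂, b₄, map_add, map_mul, map_pow, map_ofNat]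
  set Xs := W.formalXMulSq
  set η := W.formalEta
  set DX := W.formalInvariantDerivation W.formalXMulSq
  linear_combination (C W.a₁ * X - 2) * hF1 + 2 * hηX

/-! ### `ξ = 1/x = z²B`: `D(1/x)` and `D²(1/x)` -/

/-- **`D(1/x)`, cleared**: for `ξ := z²·B = z²/X = 1/x(z)` one has `Dξ = zB(2 - a₁z - a₃z³B)`, hence
`X² · Dξ = -z·Ỹ` (`D(1/x) = -(2y + a₁x + a₃)/x²`). [Blakestad–Grant 2023, §3 Lemma 10 (the
computation of `D(D(x - x(u))/(x - x(u)))`)] [folklore] -/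
theorem formalXMulSq_sq_mul_formalInvariantDerivation_xInv :
    W.formalXMulSq ^ 2 * W.formalInvariantDerivation (X ^ 2 * W.formalWDivCube) =
      -(X * ((C W.a₁ * X - 2) * W.formalXMulSq + C W.a₃ * X ^ 3)) := by
  have hkey := W.two_mul_formalWDivCube_add_mul_formalEta
  have hBX := W.formalWDivCube_mul_formalXMulSq
  have hD : W.formalInvariantDerivation (X ^ 2 * W.formalWDivCube) =
      X * ((2 * W.formalWDivCube + X * d⁄dX R W.formalWDivCube) * W.formalEta) := by
    rw [formalInvariantDerivation_apply, Derivation.leibniz, Derivation.leibniz_pow, derivative_X,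
      smul_eq_mul, smul_eq_mul]
    simp only [nsmul_eq_mul, Nat.cast_ofNat]
    ring
  rw [hD, hkey]
  set B := W.formalWDivCube
  set Xs := W.formalXMulSq
  linear_combination (X * (2 - C W.a₁ * X) * Xs - C W.a₃ * X ^ 4 * (1 + B * Xs)) * hBX

/-- **`D²(1/x)`, cleared**: `X³ · D(Dξ) = 2Ỹ² - X(6X² + b₂z²X + b₄z⁴)` for `ξ = z²B = 1/x`
(`D²(1/x) = 2(2y+a₁x+a₃)²/x³ - (6x² + b₂x + b₄)/x²`). [Blakestad–Grant 2023, §3 Lemma 10]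
[folklore] -/
theorem formalXMulSq_cube_mul_formalInvariantDerivation_sq_xInv :
    W.formalXMulSq ^ 3 *
        W.formalInvariantDerivation (W.formalInvariantDerivation (X ^ 2 * W.formalWDivCube)) =
      2 * ((C W.a₁ * X - 2) * W.formalXMulSq + C W.a₃ * X ^ 3) ^ 2 -
        W.formalXMulSq * (6 * W.formalXMulSq ^ 2 + C W.b₂ * X ^ 2 * W.formalXMulSq + C W.b₄ * X ^ 4) := by
  have hξ1 := W.formalXMulSq_sq_mul_formalInvariantDerivation_xInv
  have hF1 := W.X_mul_formalInvariantDerivation_formalXMulSq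
  have hF2 := W.X_mul_formalInvariantDerivation_formalYTilde
  set Dξ := W.formalInvariantDerivation (X ^ 2 * W.formalWDivCube) with hDξ
  -- differentiate `X²·Dξ = -zỸ`
  have hd : W.formalXMulSq ^ 2 * W.formalInvariantDerivation Dξ +
      2 * W.formalXMulSq * W.formalInvariantDerivation W.formalXMulSq * Dξ =
      -(X * W.formalInvariantDerivation ((C W.a₁ * X - 2) * W.formalXMulSq + C W.a₃ * X ^ 3) +
        ((C W.a₁ * X - 2) * W.formalXMulSq + C W.a₃ * X ^ 3) * W.formalEta) := by
    have h := congrArg W.formalInvariantDerivation hξ1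
    simp only [Derivation.leibniz, Derivation.leibniz_pow, map_neg, smul_eq_mul, nsmul_eq_mul,
      Nat.cast_ofNat, Nat.add_one_sub_one, pow_one, formalInvariantDerivation_X] at h
    linear_combination h
  -- multiply by `z·X` and cancel `z`
  apply PowerSeries.X_mul_cancel
  set D := W.formalInvariantDerivation
  set Xs := W.formalXMulSq
  set η := W.formalEta
  linear_combination X * Xs * hd - 2 * (Xs ^ 2 * Dξ) * hF1 -
    2 * (2 * η * Xs + ((C W.a₁ * X - 2) * Xs + C W.a₃ * X ^ 3)) * hξ1 - X * Xs * hF2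

end WeierstrassCurve
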